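import Summits.BirchSwinnertonDyer.BirchSwinnertonDyer.Theorems.KimAtThreeD7uTamagawaFreePlaces
import Summits.BirchSwinnertonDyer.BirchSwinnertonDyer.Theorems.KimAtThreeDeepUpperOffStratumLocalIndex
import Summits.BirchSwinnertonDyer.Rank1Residual.X11b.LocalPointsPrimaryComponent
import Literature.NumberTheory.GaloisRepresentations.HOneRestrictionOntoInvariantsFinite
import Literature.NumberTheory.EllipticCurves.LocalEulerCharacteristicTorsion
import Literature.NumberTheory.EllipticCurves.LocalKummerMap
import HarnessLib

/-!
# The TAMAGAWA-DIVISIBLE bad places, V: `𝓕_u(w)` and `H¹_ur(ℚ_w, E[p^{k+1}])` through VALUES AT FROBENIUS,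
# and `#𝓕_can(w)_k = #E[p^{k+1}]^{Γ_{ℚ_w}}`
# (cell `bsd-addord`, seat w2-tamdiv gen 4; route W2 `KimAtThreeKolyvagin`, items 19562 / 19560, «TamDiv∞»,
# POSITIVE exponent)

HONEST FRAMING: TOOL theorems (no definition, no named fact, no `sorry`); closes nothing by itself;
nothing is booked; BSD is not proved by any of this.  The cohomological half of the positive-exponent
Tamagawa index `#𝓕_can(w)_k = #𝓕_u(w)_k · #Φ_w[p^{k+1}]` (Rubin, *Euler Systems*, Lemma 1.3.5; Büyükboduk,
JNT 129 (2009) §2.1.2 Remark 2; [MR04] Prop. 6.2.6; sequel `KimAtThreeD7uTamagawaIndex`): at a finite place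
`w ∤ p` of `ℚ`, with `φ ∈ Γ_{ℚ_w}` an arithmetic Frobenius lift (`IsFrobPow φ 1`), `I_w = absInertia ℚ_w`,
`M = E[p^k · p]|_{Γ_{ℚ_w}}`:

* §1 `exists_cocycle_vanishing_inertia_apply_eq` — every `I_w`-fixed `m ∈ E[p^{k+1}]` is the value at `φ`
  of a continuous cocycle VANISHING on `I_w` (Serre, *Local Fields* XIII §1: `H¹(Ẑ, M^{I}) = M^{I}/(φ−1)`;
  the tree's free-procyclic package for FINITE coefficients); `oneCocycleClass_eq_iff_of_vanishing_inertia`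
  — two such cocycles have the same class iff their `φ`-values differ by `(φ − 1)v`, `v ∈ M^{I_w}`.
* §2 **`mem_blochKatoSelmerStructure_inr_iff_exists_cocycle`** — [MR04]'s `𝓕_u(w)` on `E[p^{k+1}]`
  (`blochKatoSelmerStructure p (tateTorsionDatum W p k) L (Sum.inr w)`, gen 2's reading) consists EXACTLY of
  the classes of `I_w`-vanishing cocycles whose value at `φ` is `π_{k+1}(a)` for an `I_w`-fixed Tate vector
  `a ∈ T_pE` (gen 2's lift `exists_unramified_tateLocalMap_eq_of_vanishing_inertia` one way; acc5 g3's
  unramified representatives `exists_rep_vanishing_inertia` the other).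
* §3 **`natCard_propagatedSelmerStructure_inr_eq_natCard_invariants`** — `#𝓕_can(w)_k = #M^{Γ_{ℚ_w}}`
  (`= #E(ℚ_w)[p^{k+1}]`): n1011 `propagatedSelmerStructure_inr_eq_kummerSelmerStructure` (`𝓕_can = 𝓛`),
  the local Kummer count `#𝓛 = #E(ℚ_w)[n] · #(ℤ_w/n)` (Milne I Lemma 3.3), `#(ℤ_w/p^{k+1}) = 1` at `w ∤ p`,
  and `#H⁰(ℚ_w, E[n]) = #E(ℚ_w)[n]` (`natCard_invariants_torsion_restrictField`).

References: J.-P. Serre, *Local Fields* XIII §1; K. Rubin, *Euler Systems* Lemma 1.3.2, 1.3.5; B. Mazur,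
K. Rubin, Mem. AMS 799 (2004) Remark A.5, Prop. 6.2.6; J. S. Milne, *ADT* I Lemma 2.9, 3.3.
-/

noncomputable section

-- the cell's Theorems namespace `Summit.BirchSwinnertonDyer.BirchSwinnertonDyer.…` repeats the summit name by design (D-0017)
set_option linter.dupNamespace false

open CategoryTheory Function Field IsDedekindDomain NumberField
open scoped NumberField Classical
open Literature.NumberTheory.GaloisRepresentations Literature.NumberTheory.EllipticCurves
open Literature.NumberTheory.GaloisRepresentations.IsNonarchimedeanLocalField
open WeierstrassCurve
open Summit.BirchSwinnertonDyer.Rank1Residual.GaloisImage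
open Summit.BirchSwinnertonDyer.Rank1Residual.X11b.AcSelmer
open Summit.BirchSwinnertonDyer.BirchSwinnertonDyer.Theorems.KimAtThreeD7uUnramifiedMembership
open Summit.BirchSwinnertonDyer.BirchSwinnertonDyer.Theorems.KimAtThreeD7uBlochKatoCondition
open Summit.BirchSwinnertonDyer.BirchSwinnertonDyer.Theorems.KimAtThreeDeepUpperOffStratumLocalIndex

namespace Summit.BirchSwinnertonDyer.BirchSwinnertonDyer.Theorems.KimAtThreeD7uTamagawaIndex

variable (W : WeierstrassCurve ℚ) [W.IsElliptic] (p : ℕ) [hp : Fact p.Prime] (k : ℕ)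
  (w : HeightOneSpectrum (𝓞 ℚ))

/-- Local notation: `T_pE|_{Γ_{ℚ_w}}` (= `tateLocalRep W p (Sum.inr w)`, by `rfl`). -/
local notation3 "𝕋" => (GaloisRep.restrictField (HeightOneSpectrum.adicCompletion ℚ w)
  (WeierstrassCurve.tateGaloisRep W p (W.continuous_galoisRepTate_holds p)).toIntRep)
/-- Local notation: `E[p^k · p]|_{Γ_{ℚ_w}}` (= `(W.torsionGaloisModule (p^k · p)).toLocal (Sum.inr w)`). -/
local notation3 "𝕄" => (GaloisRep.restrictField (HeightOneSpectrum.adicCompletion ℚ w)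
  (W.torsionGaloisModule ((p : ℤ) ^ k * (p : ℤ))))

/-! ### §1 Unramified cocycles of `E[p^{k+1}]|_{Γ_{ℚ_w}}` through their value at Frobenius -/

/-- **`H¹_ur(ℚ_w, E[p^{k+1}]) ↠ E[p^{k+1}]^{I_w}/(φ−1)`**: every `I_w`-fixed point `m` of `E[p^k · p]` is the
value at the Frobenius lift `φ` of a continuous cocycle of `Γ_{ℚ_w}` VANISHING on `I_w` (finite discrete
coefficients: the tree's free-procyclic package `exists_vanishing_apply_eq_of_isFreeProcyclic` fed by
`exists_contOneCocycles_apply_eq_of_finite`). [cite: SerreLocalFields1979, XIII §1 Prop. 1] [cite: Rubin2000, Lemma 1.3.2] -/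
theorem exists_cocycle_vanishing_inertia_apply_eq
    {φ : absoluteGaloisGroup (w.adicCompletion ℚ)} (hφ : IsFrobPow φ 1)
    {m : geomTorsion W ((p : ℤ) ^ k * (p : ℤ))}
    (hm : ∀ n : absInertia (w.adicCompletion ℚ),
      (DiscreteGaloisModule.toTopRep 𝕄).ρ (n : absoluteGaloisGroup (w.adicCompletion ℚ)) m = m) :
    ∃ ψ : contOneCocycles (DiscreteGaloisModule.toTopRep 𝕄),
      (∀ n : absInertia (w.adicCompletion ℚ), ψ.1 n = 0) ∧ ψ.1 φ = m := by
  set F := w.adicCompletion ℚ with hFdef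
  haveI := absoluteGaloisGroup_compactSpace F
  haveI : (absInertia F).Normal := absInertia_normal_holds F
  have hp0 : ((p : ℤ) ^ k * (p : ℤ)) ≠ 0 := by
    have : (p : ℤ) ≠ 0 := by exact_mod_cast hp.out.ne_zero
    exact mul_ne_zero (pow_ne_zero _ this) this
  haveI : Finite (geomTorsion W ((p : ℤ) ^ k * (p : ℤ))) :=
    finite_torsionPoints_holds W (AlgebraicClosure ℚ) hp0
  have hdense := dense_zpowers_mk_absInertia_of_isFrobPow F hφ
  exact exists_vanishing_apply_eq_of_isFreeProcyclic (DiscreteGaloisModule.toTopRep 𝕄) (absInertia F)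
    (isClosed_absInertia_holds F) (isFreeProcyclic_quotient_absInertia' F) φ hdense hm
    (exists_contOneCocycles_apply_eq_of_finite 𝕄 _ (Subgroup.isClosed_topologicalClosure _)
      (Literature.GroupTheory.dense_zpowers_mk_topologicalClosure' φ)
      (Literature.GroupTheory.exists_isOpen_index_topologicalClosure_zpowers (absInertia F)
        (isClosed_absInertia_holds F) (isFreeProcyclic_quotient_absInertia' F) φ hdense) m)

omit [W.IsElliptic] hp in
/-- **`H¹_ur(ℚ_w, E[p^{k+1}]) ↪ E[p^{k+1}]^{I_w}/(φ−1)E[p^{k+1}]^{I_w}`**: two `I_w`-vanishing continuous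
cocycles have the same class iff their values at `φ` differ by `(φ − 1)v` for an `I_w`-fixed `v`.
[cite: SerreLocalFields1979, XIII §1 Prop. 1] [cite: Rubin2000, Lemma 1.3.2] -/
theorem oneCocycleClass_eq_iff_of_vanishing_inertia
    {φ : absoluteGaloisGroup (w.adicCompletion ℚ)} (hφ : IsFrobPow φ 1)
    (z z' : contOneCocycles (DiscreteGaloisModule.toTopRep 𝕄))
    (hz : ∀ n : absInertia (w.adicCompletion ℚ), z.1 n = 0)
    (hz' : ∀ n : absInertia (w.adicCompletion ℚ), z'.1 n = 0) :
    oneCocycleClass _ z = oneCocycleClass _ z' ↔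
      ∃ v : geomTorsion W ((p : ℤ) ^ k * (p : ℤ)),
        (∀ n : absInertia (w.adicCompletion ℚ),
          (DiscreteGaloisModule.toTopRep 𝕄).ρ (n : absoluteGaloisGroup (w.adicCompletion ℚ)) v = v) ∧
        z.1 φ - z'.1 φ = (DiscreteGaloisModule.toTopRep 𝕄).ρ φ v - v :=
  oneCocycleClass_eq_iff_of_vanishing_absInertia (w.adicCompletion ℚ) (DiscreteGaloisModule.toTopRep 𝕄)
    (𝕄).continuous_smul hφ z z' hz hz'

/-! ### §2 `𝓕_u(w)` = classes of `I_w`-vanishing cocycles with Frobenius value in `π_{k+1}(T_pE^{I_w})` -/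

/-- **[MR04]'s `𝓕_u(w)` through values at Frobenius.**  At a finite `w ∤ p`, a class `x` of
`H¹(ℚ_w, E[p^k · p])` lies in `𝓕_u(w) = blochKatoSelmerStructure p (tateTorsionDatum W p k) L (Sum.inr w)`
(`= im(H¹_ur(ℚ_w, T_pE) → H¹(ℚ_w, E[p^{k+1}]))`) iff `x = [ψ]` for a continuous cocycle `ψ` VANISHING on
`I_w` whose value at the Frobenius lift `φ` is `π_{k+1}(a)` for some `I_w`-fixed `a ∈ T_pE`.  (⇐) is gen 2's
lift `exists_unramified_tateLocalMap_eq_of_vanishing_inertia`; (⇒): `x = π_{k+1,*} y` with `res_{I_w} y = 0`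
(`mem_finiteSubgroup_tate_iff`), `y = [z]` with `z` vanishing on `I_w` (acc5 `exists_rep_vanishing_inertia`),
whose value `a = z(φ)` is `I_w`-fixed, and `ψ = π_{k+1} ∘ z`.
[cite: MazurRubin2004, App. A Remark A.5 (p. 81)] [cite: Rubin2000, Lemma 1.3.2, Lemma 1.3.5] -/
theorem mem_blochKatoSelmerStructure_inr_iff_exists_cocycle
    (L : (tateTorsionDatum W p k).LocalConditionsAbove p) (hw : ((p : ℕ) : 𝓞 ℚ) ∉ w.asIdeal)
    {φ : absoluteGaloisGroup (w.adicCompletion ℚ)} (hφ : IsFrobPow φ 1)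
    (x : galoisCohomology ((W.torsionGaloisModule ((p : ℤ) ^ k * (p : ℤ))).toLocal (Sum.inr w)) 1) :
    x ∈ blochKatoSelmerStructure p (tateTorsionDatum W p k) L (Sum.inr w) ↔
      ∃ ψ : contOneCocycles (DiscreteGaloisModule.toTopRep 𝕄),
        (∀ n : absInertia (w.adicCompletion ℚ), ψ.1 n = 0) ∧
        (∃ a : W.tateModule p,
          (∀ n : absInertia (w.adicCompletion ℚ),
            (𝕋).toTopRep.ρ (n : absoluteGaloisGroup (w.adicCompletion ℚ)) a = a) ∧
          ((ψ.1 φ : geomTorsion W ((p : ℤ) ^ k * (p : ℤ))) : geomPoints W) = TateModule.proj p (k + 1) a) ∧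
        oneCocycleClass _ ψ = x := by
  constructor
  · intro hx
    rw [blochKatoSelmerStructure_inr_of_not_mem _ L hw] at hx
    obtain ⟨y, hyI, hyx⟩ := (mem_finiteSubgroup_tate_iff W p k w x).mp hx
    obtain ⟨z, hzy, hzI, hzinv⟩ := exists_rep_vanishing_inertia W p w y hyI
    refine ⟨pushCocycle W p k (Sum.inr w) z, fun n => ?_, ⟨z.1 φ, fun n => hzinv φ n, ?_⟩, ?_⟩
    · change tateToTorsion W p k (z.1 n) = 0
      rw [hzI n, map_zero]
    · rfl
    · rw [← hyx, ← hzy]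
      exact (tateLocalMap_oneCocycleClass W p k (Sum.inr w) z).symm
  · rintro ⟨ψ, hψI, ⟨a, haI, hψa⟩, rfl⟩
    exact mem_blochKatoSelmerStructure_of_exists_tateLocalMap_eq W p k w L hw
      (exists_unramified_tateLocalMap_eq_of_vanishing_inertia W p k w hφ ψ hψI ⟨a, haI, hψa⟩)

/-! ### §3 `#𝓕_can(w)_k = #E[p^{k+1}]^{Γ_{ℚ_w}}` -/

/-- Transport of the two tree counts along an equality of moduli `n = N`: the local Kummer condition has
`#𝓛_w(n) = #E(ℚ_w)[N] · #(ℤ_w/N)` (Milne I Lemma 3.3) and `#(E[n]|_{Γ_{ℚ_w}})^{Γ_{ℚ_w}} = #E(ℚ_w)[N]`.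
[cite: MilneADT2006, I Lemma 3.3] -/
theorem natCard_kummerSelmerStructure_inr_eq_natCard_invariants_mul (n : ℤ) (N : ℕ) (hN : N ≠ 0)
    (hn : n = N) :
    Nat.card (W.kummerSelmerStructure n (Sum.inr w)) =
      Nat.card (GaloisRep.restrictField (w.adicCompletion ℚ) (W.torsionGaloisModule n)).toTopRep.ρ.invariants *
        Nat.card (w.adicCompletionIntegers ℚ ⧸
          Ideal.span {((N : ℕ) : w.adicCompletionIntegers ℚ)}) := by
  subst hn
  rw [W.natCard_kummerSelmerStructure_inr w hN]
  congr 1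
  -- the `CharZero` instance is passed explicitly so that the `ℚ`-algebra structure of `ℚ_w` stays the
  -- `adicCompletion` one (not `DivisionRing.toRatAlgebra`)
  exact (@natCard_invariants_torsion_restrictField ℚ _ _ W _ (w.adicCompletion ℚ) _
    (HeightOneSpectrum.instAlgebraAdicCompletion (𝓞 ℚ) ℚ w) (charZero_adicCompletion w) N hN).symm

/-- **`#𝓕_can(w)_k = #E[p^{k+1}]^{Γ_{ℚ_w}}`** at a finite `w ∤ p` (any reduction type): Mazur–Rubin's
propagated canonical condition on `E[p^k · p]` is the local Kummer condition (n1011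
`propagatedSelmerStructure_inr_eq_kummerSelmerStructure`), of order `#E(ℚ_w)[p^{k+1}] · #(ℤ_w/p^{k+1})`
(Milne I Lemma 3.3) `= #E(ℚ_w)[p^{k+1}]` (`p` is a unit at `w`) `= #H⁰(ℚ_w, E[p^{k+1}])`.
[cite: MilneADT2006, I Lemma 3.3] [cite: Rubin2011, §3.1 (p. 29)] -/
theorem natCard_propagatedSelmerStructure_inr_eq_natCard_invariants (hw : ((p : ℕ) : 𝓞 ℚ) ∉ w.asIdeal) :
    Nat.card (propagatedSelmerStructure W p k (Sum.inr w)) =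
      Nat.card (DiscreteGaloisModule.toTopRep 𝕄).ρ.invariants := by
  have hpp : p.Prime := hp.out
  rw [propagatedSelmerStructure_inr_eq_kummerSelmerStructure W p k hw,
    natCard_kummerSelmerStructure_inr_eq_natCard_invariants_mul W w ((p : ℤ) ^ k * (p : ℤ)) (p ^ (k + 1))
      (pow_ne_zero _ hpp.ne_zero) (by push_cast; ring)]
  have hu : IsUnit (((p ^ (k + 1) : ℕ) : ℕ) : w.adicCompletionIntegers ℚ) := by
    have h := HeightOneSpectrum.isUnit_algebraMap_adicCompletionIntegers ℚ w hw
    rw [map_natCast] at h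
    rw [Nat.cast_pow]
    exact h.pow _
  rw [natCard_quotient_span_singleton_eq_one_of_isUnit hu, mul_one]

end Summit.BirchSwinnertonDyer.BirchSwinnertonDyer.Theorems.KimAtThreeD7uTamagawaIndex

end
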